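import Literature.MathematicalPhysics.QuantumFieldTheory.Balaban1983to89.B7Prop4Flat
import Literature.MathematicalPhysics.QuantumFieldTheory.Balaban1983to89.B7Prop4GeneralLevels
import Literature.MathematicalPhysics.QuantumFieldTheory.Balaban1983to89.B7Prop5Flat
import Literature.MathematicalPhysics.QuantumFieldTheory.Balaban1983to89.B7LocalityGeneral
import Literature.MathematicalPhysics.QuantumFieldTheory.Balaban1983to89.B9Ineq3137LocalSup
import Literature.MathematicalPhysics.QuantumFieldTheory.Balaban1983to89.B9Eq316TowerFlatIsOneStep

/-!
# Crux `MinimiserStabilityRegPr` (stmt-QuantumFields-19200), stub H = `hP1room`, the (P3-top-b) LINEAR JUNCTION — brick (L1):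
# the COMB-SIDE second-order remainder of [B7] Proposition 4 at the FLAT background, BOX-LOCAL in the exponent field

Cell `ym3-torus` (YM ladder rung R3 = continuum SU(2) Yang–Mills on the three-torus; NOT the Clay problem), width seat `ym-ust-19936-w2`
gen 8, free hand on LEAD-H's «H = hP1room» programme (RULING L-9, 2026-08-28).  The (P3-top-b) junction of the H lane reads the top-level
constraint `Q_k(1, ηA′)(c)` of the gauge-fixed field through its LINEAR part (plain bond-block means, brick (L3)) plus second-order remainders on
the comb side (THIS FILE) and on the exp-mean-log side (L2); the knit `H42_top_of_top` (seat `ym-ust-19936-w8`) then meets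
`B8Prop3GaugeFixedKLevel.hP3_gaugeFixed_of_b9`'s `H42` binder at `m = j = k`.

THE CONTENT.  [Balaban1985Averaging] Proposition 4, (134)–(135) pp. 38–39, at the flat background `U₀ = 1` is the tree theorem
`B7Prop4Flat.prop4_flat`: for `L ≥ 2`, `k ≥ 1` and an exponent field `B` with `‖B_b‖ ≤ b` on EVERY bond, `Lᵏ·b ≤ c₄(d)`,
`‖(1/i)·log U̿₁ᵏ(c) − Q_k B(c)‖ ≤ C₂(d)·(Lᵏb)²` and `‖(1/i)·log U̿₁ᵏ(c)‖ ≤ 2Lᵏb` at every `Lᵏ`-bond `c = ⟨Lᵏz, Lᵏz + Lᵏe_κ⟩`.  Print's locality remark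
(p. 24, after (43); p. 31, after (91); p. 34) — «depends only on the bond variables `U_b` for `b ⊂ Bᵏ(c₋) ∪ Bᵏ(c₊)`» — makes the GLOBAL bound on `B`
unnecessary: only the bonds inside the box `[loK L k z, bondHiK L k z κ]` matter.  Here:

* §1 `norm_insCfg_restr_le` — the restriction `B|_{box}` (zero outside) is globally bounded by the box bound (plumbing; the tree's copies in
  `B8Eq142KLevelLocal` ∕ `B8Prop6CubeMemberEq137` are private);
* §2 `logCovIter_one_eq_clamp` ∕ `linCovIter_one_eq_clamp` — at `U₀ = 1` the composite `logCovIter L 1 B k z κ` and its linear part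
  `linCovIter L 1 B k z κ` (the [B7]-lineage letters of `B7Prop4GeneralLevels`, the currency of `H42`) take the same values at `B` and at `B|_{box}`
  (`B7LocalityGeneral.logCovIter_congr`, `B9Ineq3137LocalSup.linCovIter_congr`);
* §3 **`norm_logCovIter_sub_linCovIter_le_loc`** — (134)–(135) at `U₀ = 1` under the BOX-LOCAL hypothesis
  `∀ x μ, BondIn (loK L k z) (bondHiK L k z κ) x μ → ‖B x μ‖ ≤ b`: `‖logCovIter L 1 B k z κ − linCovIter L 1 B k z κ‖ ≤ C2 d·(Lᵏb)²` and
  `‖logCovIter L 1 B k z κ‖ ≤ 2·(Lᵏb)` (`prop4_flat` at `B|_{box}`, read back through `B7Prop4GeneralLevels.logCovIter_one_left`,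
  `B7Prop4Flat.mlog_dbavgIter`, `B9Eq316TowerFlatIsOneStep.linCovIter_one_left` and §2); and the linear-part bound `norm_linCovIter_one_le_loc`
  (`‖linCovIter L 1 B k z κ‖ ≤ Lᵏb`, no window).

WHAT THIS IS NOT.  Pure [B7] bookkeeping at the flat background; nothing of (L2) (the eml-side remainder), the knit, `hP1room`, the stub H,
the crux, the rung R3, d = 4, a continuum limit or a mass gap is proved here.  YM₃ on T³ is rung R3 of the programme, NOT the Clay problem.

References: T. Bałaban, *Averaging operations for lattice gauge theories*, CMP **98** (1985) 17–51 [Balaban1985Averaging] (Prop. 4 (134)–(135)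
pp. 38–39; locality p. 24 after (43), p. 31 after (91), p. 34); T. Bałaban, *Propagators for lattice gauge theories in a background field*,
CMP **99** (1985) 389–434 [Balaban1985BackgroundPropagators] ((3.15)–(3.16) p. 393, the composite `Q_k`).
-/

noncomputable section

open scoped BigOperators
open Literature.MathematicalPhysics.QuantumFieldTheory.Balaban1983to89
open Literature.MathematicalPhysics.QuantumFieldTheory.Balaban1983to89.B7Prop1Explicit (Site e)
open Literature.MathematicalPhysics.QuantumFieldTheory.Balaban1983to89.B7Prop1Local (InBox AgreeOn loK bondHiK)
open Literature.MathematicalPhysics.QuantumFieldTheory.Balaban1983to89.B7Prop3Flat (insCfg expCfg)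
open Literature.MathematicalPhysics.QuantumFieldTheory.Balaban1983to89.B7Prop4Flat (C2 c4 logIter linQIter prop4_flat mlog_dbavgIter
  norm_linQIter_le)
open Literature.MathematicalPhysics.QuantumFieldTheory.Balaban1983to89.B7Prop4GeneralLevels (logCovIter linCovIter logCovIter_one_left)
open Literature.MathematicalPhysics.QuantumFieldTheory.Balaban1983to89.B7Prop5Flat (BondIn bondsIn restr mem_bondsIn insCfg_restr_of_mem
  agreeOn_insCfg_restr)
open Literature.MathematicalPhysics.QuantumFieldTheory.Balaban1983to89.B7LocalityGeneral (logCovIter_congr)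
open Literature.MathematicalPhysics.QuantumFieldTheory.Balaban1983to89.B9Ineq3137LocalSup (linCovIter_congr)
open Literature.MathematicalPhysics.QuantumFieldTheory.Balaban1983to89.B9Eq316TowerFlatIsOneStep (linCovIter_one_left)

namespace Summit.QuantumFields.YangMills.Theorems.P1FlatCoreTopCombRemainderLoc

variable {d : ℕ} {𝔸 : Type*} [NormedRing 𝔸] [NormedAlgebra ℂ 𝔸] [CompleteSpace 𝔸]

/-! ## §1 The box restriction of the exponent field -/

omit [NormedAlgebra ℂ 𝔸] [CompleteSpace 𝔸] in
/-- The restriction `B|_{box}` (zero outside the bonds of the box `[lo, hi]`) is bounded on EVERY bond by a bound of `B` on the box's bonds.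
[folklore] -/
theorem norm_insCfg_restr_le {lo hi : Site d} {B : Site d → Fin d → 𝔸} {b : ℝ}
    (hB : ∀ x μ, BondIn lo hi x μ → ‖B x μ‖ ≤ b) (hb : 0 ≤ b) (x : Site d) (μ : Fin d) :
    ‖insCfg (bondsIn lo hi) (restr (bondsIn lo hi) B) x μ‖ ≤ b := by
  by_cases h : (x, μ) ∈ bondsIn lo hi
  · rw [insCfg_restr_of_mem _ _ h]; exact hB x μ (mem_bondsIn.mp h)
  · simp only [insCfg, h, dite_false, norm_zero]; exact hb

/-! ## §2 At `U₀ = 1` the composite and its linear part see only the box -/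

/-- **LOCALITY, flat background**: `Q_k(1, B)(c) = Q_k(1, B|_{box})(c)` for the box `[loK L k z, bondHiK L k z κ] = Bᵏ(c₋) ∪ Bᵏ(c₊)` of the
`Lᵏ`-bond `c = ⟨z, z + e_κ⟩` (`B7LocalityGeneral.logCovIter_congr` at `U₀ = U₀' = 1`). [cite: Balaban1985Averaging, p.24 (after (43)), p.31 (after (91))] -/
theorem logCovIter_one_eq_clamp (L : ℕ) (hL : 1 ≤ L) (B : Site d → Fin d → 𝔸) (k : ℕ) (z : Site d) (κ : Fin d) :
    logCovIter L (1 : Site d → Fin d → 𝔸ˣ) B k z κ =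
      logCovIter L (1 : Site d → Fin d → 𝔸ˣ) (insCfg (bondsIn (loK L k z) (bondHiK L k z κ))
        (restr (bondsIn (loK L k z) (bondHiK L k z κ)) B)) k z κ :=
  logCovIter_congr L hL k z κ (fun _ _ _ _ => rfl) (agreeOn_insCfg_restr (loK L k z) (bondHiK L k z κ) B)

/-- **LOCALITY of the linear part, flat background**: `LᵏQ_k(1)B(c) = LᵏQ_k(1)(B|_{box})(c)` (`B9Ineq3137LocalSup.linCovIter_congr` at
`U₀ = U₀' = 1`). [cite: Balaban1985Averaging, p.38 (before (133)), p.24 (after (43))] -/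
theorem linCovIter_one_eq_clamp (L : ℕ) (hL : 1 ≤ L) (B : Site d → Fin d → 𝔸) (k : ℕ) (z : Site d) (κ : Fin d) :
    linCovIter L (1 : Site d → Fin d → 𝔸ˣ) B k z κ =
      linCovIter L (1 : Site d → Fin d → 𝔸ˣ) (insCfg (bondsIn (loK L k z) (bondHiK L k z κ))
        (restr (bondsIn (loK L k z) (bondHiK L k z κ)) B)) k z κ :=
  linCovIter_congr L hL k z κ (fun _ _ _ _ => rfl) (agreeOn_insCfg_restr (loK L k z) (bondHiK L k z κ) B)

/-! ## §3 Proposition 4 at `U₀ = 1`, box-local in `B` -/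

variable [NormOneClass 𝔸]

/-- **THE LINEAR PART IS BOUNDED BY THE BOX DATA** (no window): `‖LᵏQ_k(1)B(c)‖ ≤ Lᵏ·b` when `‖B_b‖ ≤ b` on the bonds of
`Bᵏ(c₋) ∪ Bᵏ(c₊)` (`B7Prop4Flat.norm_linQIter_le` at `B|_{box}`; `L ≥ 1`). [cite: Balaban1985Averaging, (125) p.36, (127) p.37] -/
theorem norm_linCovIter_one_le_loc (L : ℕ) (hL : 1 ≤ L) (k : ℕ) (z : Site d) (κ : Fin d) (B : Site d → Fin d → 𝔸) {b : ℝ}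
    (hb : 0 ≤ b) (hB : ∀ x μ, BondIn (loK L k z) (bondHiK L k z κ) x μ → ‖B x μ‖ ≤ b) :
    ‖linCovIter L (1 : Site d → Fin d → 𝔸ˣ) B k z κ‖ ≤ (L : ℝ) ^ k * b := by
  have hB' := norm_insCfg_restr_le hB hb
  rw [linCovIter_one_eq_clamp L hL B k z κ, linCovIter_one_left L hL _ hb hB' k]
  exact norm_linQIter_le L hL _ hb hB' k z κ

/-- **[B7] PROPOSITION 4 (134)–(135) AT THE FLAT BACKGROUND, BOX-LOCAL IN THE EXPONENT FIELD.**  Let `L ≥ 2`, `k ≥ 1`, `c = ⟨z, z + e_κ⟩` an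
`Lᵏ`-bond, and `B` an exponent field with `‖B_b‖ ≤ b` on the bonds `b ⊂ Bᵏ(c₋) ∪ Bᵏ(c₊)` (`BondIn (loK L k z) (bondHiK L k z κ)`), `Lᵏ·b ≤ c₄(d)`.
Then `‖Q_k(1, B)(c) − LᵏQ_k(1)B(c)‖ ≤ C₂(d)·(Lᵏb)²` and `‖Q_k(1, B)(c)‖ ≤ 2·Lᵏb` in the `logCovIter`∕`linCovIter` letters of
`B7Prop4GeneralLevels` (the currency of `B8Prop3GaugeFixedKLevel`'s `H42`).  Proof: `B7Prop4Flat.prop4_flat` at the restriction `B|_{box}`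
(globally bounded by `b`, §1), the flat reductions `logCovIter_one_left`∕`mlog_dbavgIter`∕`linCovIter_one_left`, and locality (§2).
[cite: Balaban1985Averaging, Prop. 4 (134)–(135) pp.38–39, p.24 (after (43)), p.31 (after (91))] -/
theorem norm_logCovIter_sub_linCovIter_le_loc (L : ℕ) (hL : 2 ≤ L) (k : ℕ) (hk : 1 ≤ k) (z : Site d) (κ : Fin d)
    (B : Site d → Fin d → 𝔸) {b : ℝ} (hb : 0 ≤ b)
    (hB : ∀ x μ, BondIn (loK L k z) (bondHiK L k z κ) x μ → ‖B x μ‖ ≤ b) (hkb : (L : ℝ) ^ k * b ≤ c4 d) :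
    ‖logCovIter L (1 : Site d → Fin d → 𝔸ˣ) B k z κ - linCovIter L (1 : Site d → Fin d → 𝔸ˣ) B k z κ‖ ≤
        C2 d * ((L : ℝ) ^ k * b) ^ 2 ∧
      ‖logCovIter L (1 : Site d → Fin d → 𝔸ˣ) B k z κ‖ ≤ 2 * ((L : ℝ) ^ k * b) := by
  have hL1 : 1 ≤ L := le_trans (by norm_num) hL
  -- the clamped field and its global bound
  set B' := insCfg (bondsIn (loK L k z) (bondHiK L k z κ)) (restr (bondsIn (loK L k z) (bondHiK L k z κ)) B) with hB'_def
  have hB' : ∀ x μ, ‖B' x μ‖ ≤ b := norm_insCfg_restr_le hB hb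
  -- Prop. 4 at the flat background for the clamped field
  obtain ⟨hrem, habs, -⟩ := prop4_flat L hL B' hb hB' k hk hkb z κ
  -- flat reductions: `mlog U̿₁ᵏ(c) = logIter = logCovIter L 1`, `linQIter = linCovIter L 1`
  obtain ⟨j, rfl⟩ : ∃ j, k = j + 1 := ⟨k - 1, by omega⟩
  have hval : MatrixLog.mlog ((B7Prop4Flat.dbavgIter L (expCfg B') (j + 1) z κ : 𝔸ˣ) : 𝔸) =
      logCovIter L (1 : Site d → Fin d → 𝔸ˣ) B' (j + 1) z κ := by
    rw [mlog_dbavgIter L hL B' hb hB' j hkb z κ, logCovIter_one_left]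
  have hlin : linQIter L B' (j + 1) z κ = linCovIter L (1 : Site d → Fin d → 𝔸ˣ) B' (j + 1) z κ := by
    rw [linCovIter_one_left L hL1 B' hb hB' (j + 1)]
  rw [hval, hlin] at hrem
  rw [hval] at habs
  -- locality: back to `B`
  rw [logCovIter_one_eq_clamp L hL1 B (j + 1) z κ, linCovIter_one_eq_clamp L hL1 B (j + 1) z κ]
  exact ⟨hrem, habs⟩

end Summit.QuantumFields.YangMills.Theorems.P1FlatCoreTopCombRemainderLoc

end
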